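import Summits.PneNP.PneNP.Theses.ExpanderLinearGenerators
import Literature.Computability.Complexity.ProofComplexityNP
import Literature.Computability.MetaComplexity.ProofSystemsProofs

/-!
# Route ExpanderLinearGenerators — the target `NoPolyBoundedProofSystem` is exactly `NP ≠ coNP`

Helper file for item `stmt-PneNP-0097` (the rank-0 target
`Summit.PneNP.PneNP.Theses.ExpanderLinearGenerators.NoPolyBoundedProofSystem :=
 ¬ HasPolyBoundedProofSystem TAUT`, shared verbatim by the routes ProofCplx, AperiodicTorus,
LyapunovRefutations, MatroidTseitin).

What is recorded here (kernel-checked, no named fact left as a hypothesis):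

* `noPolyBoundedProofSystem_iff_TAUT_not_mem_NP`: the target is equivalent to `TAUT ∉ NP`
  (Cook–Reckhow 1979, Prop. 1.4, general form `HasPolyBoundedProofSystem L ↔ L ∈ NP`,
  discharged in the tree as `hasPolyBoundedProofSystem_iff_mem_NP_holds`);
* `noPolyBoundedProofSystem_iff_NP_ne_coNP`: the target is equivalent to `NP ≠ coNP` over the
  tree's classes (Cook–Reckhow 1979, Prop. 1.1, discharged in the tree as
  `NP_eq_coNP_iff_hasPolyBoundedProofSystem_TAUT_holds`, which rests on the formalised Cook–Levin
  hardness of `TAUT` for `coNP`).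

Consequently the item is, inside the tree and not only in print, the open problem `NP ≠ coNP`
(Krajíček, *Proof complexity* (2019), Problem 1.5.3); neither it nor its negation is provable by
the methods available to a route prover, and a proof of the negation would be `NP = coNP`.

Sources: S. A. Cook, R. A. Reckhow, *The relative efficiency of propositional proof systems*,
J. Symbolic Logic 44 (1979), §1, Prop. 1.1 and Prop. 1.4; J. Krajíček, *Proof complexity*,
CUP 2019, Thm. 1.1.3 and Problem 1.5.3.
-/

set_option linter.dupNamespace false -- `Summit.PneNP.PneNP.…`: summit = sub-problem name (D-0017 single-conjunct layout)

namespace Summit.PneNP.PneNP.Theorems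

open Literature.Computability.Complexity Literature.Computability.MetaComplexity
open Summit.PneNP.PneNP.Theses.ExpanderLinearGenerators

/-- The route target `NoPolyBoundedProofSystem` (`TAUT` has no polynomially bounded Cook–Reckhow
proof system) is equivalent to `TAUT ∉ NP`, by Cook–Reckhow's Prop. 1.4 in the general form
`HasPolyBoundedProofSystem L ↔ L ∈ NP` (tree: `hasPolyBoundedProofSystem_iff_mem_NP_holds`).
[cite: CookReckhow1979, §1 Prop. 1.4] -/
theorem noPolyBoundedProofSystem_iff_TAUT_not_mem_NP :
    NoPolyBoundedProofSystem ↔ TAUT ∉ Nondeterministic.NP := by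
  unfold NoPolyBoundedProofSystem
  exact not_congr hasPolyBoundedProofSystem_iff_mem_NP_holds

/-- The route target `NoPolyBoundedProofSystem` is equivalent to `NP ≠ coNP` over the tree's
classes (`Nondeterministic.NP`, `coNP = co NP`), by Cook–Reckhow's Prop. 1.1
(tree: `NP_eq_coNP_iff_hasPolyBoundedProofSystem_TAUT_holds`). In particular item
`stmt-PneNP-0097` is literally the open problem `NP ≠ coNP`. [cite: CookReckhow1979, §1 Prop. 1.1] -/
theorem noPolyBoundedProofSystem_iff_NP_ne_coNP :
    NoPolyBoundedProofSystem ↔ Nondeterministic.NP ≠ coNP := by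
  have h : Nondeterministic.NP = coNP ↔ HasPolyBoundedProofSystem TAUT :=
    NP_eq_coNP_iff_hasPolyBoundedProofSystem_TAUT_holds
  unfold NoPolyBoundedProofSystem
  exact not_congr h.symm

end Summit.PneNP.PneNP.Theorems
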